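import Mathlib
import Literature.MathematicalPhysics.QuantumFieldTheory.Balaban1983to89.B13Sect1Arith

/-!
# `Balaban1983to89.B13TermCensus334` — kernel bookkeeping of the transfer census for the Taylor terms of (I.3.34) in B13 Lemma 1

CITATION HEADER (lean-in-tree rule 2026-08-18).  [II] = T. Bałaban, *Renormalization group approach to lattice gauge
field theories. II. Cluster expansions*, Commun. Math. Phys. **116**, 1–22 (1988) [Balaban1988RG2Cluster] (cell paper
B13; held `paper:balaban1988-cmp116-rg-ii-cluster`, journal page = PDF page), Sect. 1 pp. 7–8; [I] = T. Bałaban,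
*Renormalization group approach to lattice gauge field theories. I. Generation of effective actions in a small field
approximation and a coupling constant renormalization in four dimensions*, Commun. Math. Phys. **109**, 249–301 (1987)
[Balaban1987RG1] (cell paper B12), Sect. 3 pp. 276–281, Sect. 4 pp. 281–292, Sect. 5 pp. 297–298.  Render-checked
2026-08-18 on `b2b-balaban-ref1/pages/1988-cmp116-rg-II-cluster/1988-cmp116-rg-II-cluster-p007-x2.png`, `…-p008-x2.png`
and `b2b-balaban-ref1/pages/1987-cmp109-rg-I-small-field/1987-cmp109-rg-I-small-field-p029/p032/p033/p034/p036/
p037/p038/p039/p040/p041/p042/p043/p044/p049/p050-x2.png` (read as images, not from the OCR layer).  BOTH papers are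
UNDER ADJUDICATION by the audit cell `pub-balaban`; nothing of them is asserted here: every printed analytic input
((I.3.54), (I.4.5), (I.4.22), (I.4.36), (I.5.44), the cube and site counts, (1.26), (1.27), (1.28), the level bounds)
enters as an explicit HYPOTHESIS over abstract reals / finite index sets / an abstract real-linear map, and what is
proved is proved by the kernel from Mathlib (real arithmetic, `Real.add_one_le_exp`, `Real.rpow` algebra,
`geom_sum_eq`) and from the sibling module `…Balaban1983to89.B13Sect1Arith` (unit pv20-g2: the iterated Cauchy
operation `cauchyOp` of (1.23), `norm_cauchyOp_le'`, `cauchy_factor_pow_le`, `exponent_129`, `sum_le_card_mul`).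
This module is a NEW sibling of `B13.lean`, `B13Sect1Arith.lean`, `B13Closing.lean`; it imports Mathlib and
`B13Sect1Arith` and modifies nothing.  Unit `b2b-balaban-b13-g6` (planner, PAPER SUB-CELL B13 gen 6); cell records
GAPS C-B13-14 (G-B13-01 = class L3 of C-adv9-21 certified by template with the typed census
`HOME/b2b-balaban-b13/CENSUS-L3-334.md`), C-B13-15 (G-B13-03 first half), G-B13-14a–d (located residuals, all LOW),
DIVERGENCE D-b13.15 (the modelling conventions listed at the end of this header).

WHAT IS PRINTED.  [II] p. 8, verbatim: *"The simplest situation is for the remaining terms on the right-hand side of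
(I.3.34), or rather for expressions obtained by the transformations described in Sect. I.4. We apply the expansion
(1.10) to them, and the terms in this expansion can be bounded similarly as in (1.24), using the inequalities (I.4.5),
(I.4.22), (I.4.36), (I.5.44), and other inequalities mentioned in the previous sections. The summation over all
possible choices of □₀, Y₀, j, X yields an expression satisfying (1.29)."*; [II] p. 7: *"We were doing all the
considerations for the last term in (I.3.34), hence we estimate the above expression using (I.3.54). We get (1.24)"*.
The census establishes (from the renders) that every such term depends on (U, J, B) only through H_k(U, J, ·) inside
the fields B = Q_j(ηA), A = A((tζ̃_□ + t_□ζ_□)H_k(B′), ·) and — LINEARLY — δB = δB(ζ_□H_k(B′)) of (I.4.6)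
((4.6) itself prints ζ_□H_j(B′) [sic]; H_k(B′) in the line before it, *"(tζ̃_□ + t_□ζ_□)H_k(B′)"*, and in the two
lines after it — render p034; v1.1), the Taylor
kernels E^{(n)}(X; ·) being numerical ((I.4.2)–(I.4.4): *"the function with U = 1, J = 0"*), so that (1.10) applies
verbatim and every term acquires the factor 1/|t_□| = 8B₀C₁e^{16κ₁}α₂⁻¹g_k|B| of (1.22) either by Cauchy's formula
on the t_□-circle (undifferentiated forms, `B13Sect1Arith.bound_124` with S := the printed sup bound) or by
linearity in ζ_□H_k(B′) (differentiated forms, Part A below), while the (□′, X)/site- and j-levels of the gathering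
(1.29) close with per-type weights (Parts C, D).

WHAT IS CERTIFIED (kernel, 0 sorry).
* Part A (the factor 1/r_t for every term): `linear_scaling` (‖T h‖ ≤ (‖h‖/ρ)·V for a real-linear T bounded by V
  on the ball of radius ρ — the admissible-field scaling), `factor_eq_inv_radius` / `factor_le_inv_radius`
  ((4bC₁a)/(½α₂) = 8bC₁α₂⁻¹a, the right side of (1.22)), `norm331_on_contours` (R7 + (1.22) ⇒ the (I.3.31)
  hypothesis of [I] Lemma 4 holds with ¼α₂ + ½α₂ < α₂ on all contours), `bound_124_linear` (the (1.24)-shape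
  (1/r)·V·exp(−(κ₁ − 1)N) for a differentiated form: iterated σ-contours of (1.23) × linear scaling).
* Part B (G-B13-03 first half): `sup124_of_354`, `sup124_of_354'` ((I.3.54) E₀α₃⁻⁵|B|⁵e^{−κd_j(X)} with |B| ≤ α₁L^jη
  gives EXACTLY (1.24)'s E₀(α₁/α₃)⁵(L^jη)⁵e^{−κd_j(X)}).
* Part C (the gathering (1.29) with abstract weights): `gather_weighted` (the nested sum over □₀, Y₀, j, □′, X of
  `B13Sect1Arith.gather_129` with the weight (L^jη)⁵ and the level bounds "(6L)⁴L^jη", "2(6L)⁴" replaced by an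
  abstract weight w_j, level constants c_j and total C: Σ ≤ K·O(1)·C·e·exp(⅛κ₁d_k(□₀))·exp(−(1/16)κ₁d_k(Y))),
  `gather_sites` (the same for X-PRE-SUMMED types (I.4.36)/(I.5.44): inner index = sites, Σ_ι R_j(ι) ≤ W_j,
  Σ_j W_j ≤ C).
* Part D (the weight arithmetic of the census table): `pow_mul_exp_neg_le` (xᵐe^{−x} ≤ mᵐe^{−m}), `pow_inv_exp_le`
  (u⁻ᵐe^{−a/u} ≤ (m/a)ᵐe^{−m}: the exponential factors e^{−δ₀M(L^jη)⁻¹} of (I.4.5) and e^{−(L^jη)⁻¹} of (I.4.36)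
  traded for powers of L^jη), `weight_exp_le` ((L^jη)ⁿ·e^{−a/(L^jη)} ≤ (m/a)ᵐe^{−m}·(L^jη)⁵ for n + m = 5: the
  m < n terms (I.4.1) and the (I.4.36)-type terms are dominated termwise by the (L^jη)⁵-class), `card_mul_weight_le`
  (the □′-count step #□′·Cℓ⁵ ≤ (6L)⁴Cℓ), `jsum_scaled_le` (the ℓ⁵-class j-sum with a constant, from
  `B13Sect1Arith.jsum_le`), `geom_ratio_sum_le`, `rpow_ratio_eq`, `jsum_rpow_le`, `jsum_rpow_scaled_le`
  (Σ_{j≤k}(L^jη)^β ≤ (1 − L^{−β})⁻¹ for η = L^{−k}, β > 0: the j-sum of the (L^jη)^{4+β}-classes (I.4.30), (I.5.43) —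
  finite BECAUSE β > 0, cell GAPS G-B13-14b).
NOT certified here (hypotheses, by name in the docstrings): the printed sup bounds (I.3.54), (I.4.5), (I.4.22),
(I.4.36), (I.5.44) and their derivations inside [I] (cell rows C-adv9-4, C-adv9-12, G-adv9-17, C-B12s-4, C-B12s-5), the
bound |δB| ≤ O(1)L^jη ([I] p. 282 *"satisfy the bounds (3.32)"*), the cube/site counts (6L)⁴(L^jη)⁻⁴ and
M⁴(L^jη)⁻⁴ and the lattice moment sums c_a(δ₁) (the papers' numerals), (1.26), (1.27), (1.28) (kernel elsewhere:
`B13Sect1Arith`, `B12TreeDecay`), the analyticity of s ↦ H_k(s; B′) ((1.18)–(1.21)) and Cauchy's formula itself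
([folklore]).  MODELLING CONVENTIONS (DIVERGENCE D-b13.15): norms of field functionals are abstract nonnegative reals;
the linear dependence of δB on h = ζ_□H_k(B′) is an abstract real-linear map between real normed spaces and the
admissible set of [I] Lemma 4 (three norms (I.3.31)) is modelled by ONE norm ball of radius ½α₂; b abbreviates
B₀e^{16κ₁}, a abbreviates g_k|B|; index families {□₀}, {Y₀}, {□′}, {X}, {sites} are abstract finite sets with the
printed level bounds as hypotheses; ℓ_j = L^j·(L^k)⁻¹ with natural exponents and ℓ_j^β is `Real.rpow`.
Value = kernel certificate of the census bookkeeping with every threshold explicit, NOT summit progress.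

v1.1 (b2b-balaban-b13-g7, 2026-08-18, DOCFIX after XREAD ref6-g11 E58 / GAPS G-ref6-2 + advisory A1): docstring-only —
locator of (I.3.54) and of *"Because |B| < O(1)L^jη …"* corrected p. 281 → p. 280 (render p032) in `sup124_of_354`;
[sic] marks where δB's formula is attributed to (I.4.6) ((4.6) prints H_j(B′), the surrounding text H_k(B′), render
p034).  No statement, proof or declaration name changed.
-/

noncomputable section

namespace Literature.MathematicalPhysics.QuantumFieldTheory.Balaban1983to89.B13TermCensus334

open Literature.MathematicalPhysics.QuantumFieldTheory.Balaban1983to89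

/-! ## Part A. The factor 1/|t_□| of (1.22) for every term of (I.3.34) -/

/-- THE ADMISSIBLE-FIELD SCALING behind *"bounded similarly as in (1.24)"* ([II] p. 8) for the t_□-DIFFERENTIATED
forms (I.4.20) Σ_{n=2}^4 (1/(n−1)!)⟨E^{(n)}, δB, ⊗^{n−1}B⟩: by (I.4.6) δB = ⟨(δ/δA)Q_j(ηA), η⟨(δ/δA)A, ζ_□H_k(B′)⟩⟩ ((4.6)
prints *"ζ_□H_j(B′)"* [sic], H_k(B′) in the surrounding lines of p. 282 — render p034; v1.1) is LINEAR in
h = ζ_□H_k(B′), and [I]'s bounds ((I.4.22) etc.) hold for every admissible h′, i.e. (model) for every h′ in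
the ball of radius ρ = ½α₂ (the (I.3.31)-room left by R7, `norm331_on_contours`).  Hence for the actual h:
‖T h‖ ≤ (‖h‖/ρ)·V.  [folklore: operator-norm scaling] -/
theorem linear_scaling {E F : Type*} [NormedAddCommGroup E] [NormedSpace ℝ E] [NormedAddCommGroup F]
    [NormedSpace ℝ F] (T : E →ₗ[ℝ] F) {ρ V : ℝ} (hρ : 0 < ρ) (hV : ∀ h' : E, ‖h'‖ ≤ ρ → ‖T h'‖ ≤ V)
    (h : E) : ‖T h‖ ≤ (‖h‖ / ρ) * V := by
  have hV0 : 0 ≤ V := le_trans (norm_nonneg _) (hV 0 (by simpa using hρ.le))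
  by_cases hh : h = 0
  · subst hh; simp
  · have hn : 0 < ‖h‖ := norm_pos_iff.mpr hh
    set c : ℝ := ρ / ‖h‖ with hc
    have hc0 : 0 < c := div_pos hρ hn
    have h1 : ‖c • h‖ ≤ ρ := by
      rw [norm_smul, Real.norm_of_nonneg hc0.le, hc, div_mul_cancel₀ ρ hn.ne']
    have h2 := hV (c • h) h1
    rw [map_smul, norm_smul, Real.norm_of_nonneg hc0.le] at h2
    have h3 : ‖T h‖ ≤ V / c := by
      rw [le_div_iff₀ hc0]; linarith [h2]
    calc ‖T h‖ ≤ V / c := h3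
      _ = (‖h‖ / ρ) * V := by rw [hc]; field_simp

/-- (1.21) + (1.22), [II] p. 7: with ‖h‖ ≦ 4B₀C₁e^{16κ₁}g_k|B| (*"|H_k(s(Y₀), B′)| ≦ 4B₀C₁e^{16κ₁}g_k|B| … and the same
for all admissible norms"*) and ρ = ½α₂, the scaling factor ‖h‖/ρ is at most (4bC₁a)/(½α₂) = 8bC₁α₂⁻¹a = the
printed 1/|t_□| of (1.22) (`B13Sect1Arith.eq_122`): the differentiated and the undifferentiated forms acquire the
SAME factor (census template 𝕋a = 𝕋b). [cite: Balaban1988RG2Cluster, (1.22) p.7] -/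
theorem factor_eq_inv_radius {b C₁ α₂ a : ℝ} (hα : 0 < α₂) :
    (4 * b * C₁ * a) / ((1 / 2) * α₂) = 8 * b * C₁ * α₂⁻¹ * a := by
  field_simp
  ring

/-- Monotonicity of the scaling factor in ‖h‖: ‖h‖ ≦ 4bC₁a ⇒ ‖h‖/(½α₂) ≦ 8bC₁α₂⁻¹a.
[cite: Balaban1988RG2Cluster, (1.21)–(1.22) p.7] -/
theorem factor_le_inv_radius {b C₁ α₂ a nh : ℝ} (hα : 0 < α₂) (hnh : nh ≤ 4 * b * C₁ * a) :
    nh / ((1 / 2) * α₂) ≤ 8 * b * C₁ * α₂⁻¹ * a := by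
  rw [← factor_eq_inv_radius hα]
  exact div_le_div_of_nonneg_right hnh (by positivity)

/-- THE (I.3.31)-HYPOTHESIS OF [I] LEMMA 4 ON ALL CONTOURS ([II] p. 7; [I] p. 276 (3.31), p. 280 Lemma 4 *"A defined
on □₀ and satisfying (3.31)"*): the norm of A = (tζ̃_□ + t_□ζ_□)H_k(σ(Y₀), B′) is at most t·(4bC₁ε₁) + |t_□|·‖H_k‖ with
t ∈ [0, 1], R7 *"4B₀C₁e^{16κ₁}ε₁ ≦ ¼α₂, and this implies that the product with tζ̃_□ satisfies (I.3.31) with ½α₂"* and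
the t_□-circle (1.22) *"|t_□|4B₀C₁e^{16κ₁}g_k|B| ≦ ½α₂"*: total ≦ ¼α₂ + ½α₂ < α₂.  (Every [I]-§4 bound used by the census
is stated under exactly this hypothesis, for ANY such A — the modularity [I] p. 273 spells out for (3.17).)
[cite: Balaban1988RG2Cluster, (1.22) p.7] [cite: Balaban1987RG1, (3.31) p.276] -/
theorem norm331_on_contours {b C₁ α₂ ε₁ t n₁ n₂ : ℝ} (hα : 0 < α₂) (hR7 : 4 * b * C₁ * ε₁ ≤ (1 / 4) * α₂)
    (ht : t ∈ Set.Icc (0:ℝ) 1) (hn₁ : n₁ ≤ t * (4 * b * C₁ * ε₁)) (hn₂ : n₂ ≤ (1 / 2) * α₂) :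
    n₁ + n₂ < α₂ := by
  obtain ⟨ht0, ht1⟩ := ht
  have h1 : t * (4 * b * C₁ * ε₁) ≤ t * ((1 / 4) * α₂) := mul_le_mul_of_nonneg_left hR7 ht0
  have h2 : t * ((1 / 4) * α₂) ≤ (1 / 4) * α₂ := by nlinarith
  linarith

section Cauchy

variable {E : Type*} [NormedAddCommGroup E] [NormedSpace ℂ E]
variable {ι : Type*} [DecidableEq ι]

/-- **(1.24)-SHAPE FOR A DIFFERENTIATED FORM** (census template 𝕋b): the d/dt_□|₀-coefficient of a term of (I.3.34)
after the s-continuation (1.23) is the iterated σ-contour operation `B13Sect1Arith.cauchyOp` (radius e^{κ₁}, κ₁ ≥ 1,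
over the list of the N cubes of Y₀∖□̃⁴) applied to a function g(s, σ) = (form linear in h)(s, σ) whose norm on the
contours is ≤ (‖h‖/(½α₂))·V by `linear_scaling`, V = the [I]-printed bound for admissible fields ((I.4.22),
(I.4.30), (I.4.36)-, (I.5.44)-type — a HYPOTHESIS `hg`), ‖h‖ ≤ 4bC₁a by (1.21) (`hnh`).  CONCLUSION: norm ≤
8bC₁α₂⁻¹a · V · exp(−(κ₁ − 1)N) — (1.24) with E₀(α₁/α₃)⁵(L^jη)⁵e^{−κd_j(X)} replaced by V.
[cite: Balaban1988RG2Cluster, (1.23)–(1.24) p.7] -/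
theorem bound_124_linear {κ₁ b C₁ α₂ a V nh : ℝ} (hκ : 1 ≤ κ₁) (hα : 0 < α₂) (hV : 0 ≤ V) (hnh0 : 0 ≤ nh)
    (hnh : nh ≤ 4 * b * C₁ * a) (l : List ι) (g : (ι → ℝ) → (ι → ℂ) → E)
    (hg : ∀ s σ, (∀ i ∈ l, s i ∈ Set.Icc (0:ℝ) 1 ∧ σ i ∈ Metric.sphere (0:ℂ) (Real.exp κ₁)) →
      ‖g s σ‖ ≤ (nh / ((1 / 2) * α₂)) * V)
    (s : ι → ℝ) (σ : ι → ℂ) (hsσ : ∀ i ∈ l, s i ∈ Set.Icc (0:ℝ) 1 ∧ σ i ∈ Metric.sphere (0:ℂ) (Real.exp κ₁)) :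
    ‖B13Sect1Arith.cauchyOp (Real.exp κ₁) l g s σ‖
      ≤ (8 * b * C₁ * α₂⁻¹ * a) * V * Real.exp (-(κ₁ - 1) * l.length) := by
  have hρ : 1 < Real.exp κ₁ := by
    have := Real.add_one_le_exp κ₁; linarith
  have step1 := B13Sect1Arith.norm_cauchyOp_le' hρ l g hg s σ hsσ
  refine step1.trans ?_
  have hF := B13Sect1Arith.cauchy_factor_pow_le hκ l.length
  have hfac := factor_le_inv_radius (b := b) (C₁ := C₁) (a := a) hα hnh
  have hc0 : 0 ≤ nh / ((1 / 2) * α₂) * V := by positivity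
  calc (Real.exp κ₁ / (Real.exp κ₁ - 1) ^ 2) ^ l.length * (nh / ((1 / 2) * α₂) * V)
      ≤ Real.exp (-(κ₁ - 1) * l.length) * ((8 * b * C₁ * α₂⁻¹ * a) * V) :=
        mul_le_mul hF (mul_le_mul_of_nonneg_right hfac hV) hc0 (Real.exp_pos _).le
    _ = (8 * b * C₁ * α₂⁻¹ * a) * V * Real.exp (-(κ₁ - 1) * l.length) := by ring

end Cauchy

/-! ## Part B. G-B13-03 first half: (I.3.54) gives the sup factor of (1.24) -/

/-- **(I.3.54) ⇒ the constant of (1.24)** ([II] p. 7 *"hence we estimate the above expression using (I.3.54)"*; [I]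
p. 280 (3.54) (render p032; v1.1 DOCFIX: locator was "p. 281", corrected after XREAD GAPS G-ref6-2 — Lemma 4, (3.53),
(3.54) and the sentence quoted next are all on journal p. 280), verbatim: *"≦ E₀α₃⁻⁵|B|⁵exp(−κd_j(X)) … Because
|B| < O(1)L^jη, e.g. |B| < α₁L^jη, hence we have the required bound"*): with nB = |B| ≤ α₁ℓ, ℓ = L^jη, the
(I.3.54) bound E₀α₃⁻⁵nB⁵·e (e = exp(−κd_j(X)) ≥ 0) is at most
E₀(α₁/α₃)⁵ℓ⁵·e — EXACTLY the factor printed in (1.24).  Both (I.3.54) and |B| < α₁L^jη are HYPOTHESES (cell GAPS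
C-B13-15; the [I]-internal derivation of (3.54): C-adv9-4). [cite: Balaban1988RG2Cluster, (1.24) p.7]
[cite: Balaban1987RG1, (3.54) p.280] -/
theorem sup124_of_354 {E₀ α₁ α₃ ℓ nB e : ℝ} (hE : 0 ≤ E₀) (hα₃ : 0 < α₃) (hnB0 : 0 ≤ nB)
    (hnB : nB ≤ α₁ * ℓ) (he : 0 ≤ e) :
    E₀ * (α₃⁻¹) ^ 5 * nB ^ 5 * e ≤ E₀ * (α₁ / α₃) ^ 5 * ℓ ^ 5 * e := by
  have h1 : nB ^ 5 ≤ (α₁ * ℓ) ^ 5 := pow_le_pow_left₀ hnB0 hnB 5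
  have h0 : 0 ≤ E₀ * (α₃⁻¹) ^ 5 := by positivity
  calc E₀ * (α₃⁻¹) ^ 5 * nB ^ 5 * e ≤ E₀ * (α₃⁻¹) ^ 5 * (α₁ * ℓ) ^ 5 * e :=
        mul_le_mul_of_nonneg_right (mul_le_mul_of_nonneg_left h1 h0) he
    _ = E₀ * (α₁ / α₃) ^ 5 * ℓ ^ 5 * e := by rw [div_eq_mul_inv]; ring

/-- The composed sup bound in the form used by `B13Sect1Arith.bound_124` (its hypothesis hS′ with S = E₀(α₁/α₃)⁵ℓ⁵e):
any quantity ≤ the (I.3.54) bound is ≤ S. [cite: Balaban1988RG2Cluster, (1.24) p.7] -/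
theorem sup124_of_354' {E₀ α₁ α₃ ℓ nB e q : ℝ} (hE : 0 ≤ E₀) (hα₃ : 0 < α₃) (hnB0 : 0 ≤ nB)
    (hnB : nB ≤ α₁ * ℓ) (he : 0 ≤ e) (hq : q ≤ E₀ * (α₃⁻¹) ^ 5 * nB ^ 5 * e) :
    q ≤ E₀ * (α₁ / α₃) ^ 5 * ℓ ^ 5 * e :=
  hq.trans (sup124_of_354 hE hα₃ hnB0 hnB he)

/-! ## Part C. The gathering (1.29) with abstract weights (*"The summation over all possible choices of □₀, Y₀, j, X
yields an expression satisfying (1.29)"*, [II] p. 8) -/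

/-- **(1.29) WITH AN ABSTRACT WEIGHT** — the nested-sum bookkeeping of `B13Sect1Arith.gather_129` (□₀ ∈ `S0`, Y₀ ∈
`SY □₀`, j ∈ {0,…,k}, □′ ∈ `Sq j`, X ∈ `SX j □′`) with the term bound K·w_j·exp(−κ′d_j(X))·(1.25)-factor (`hT`; for
the worked example w_j = (L^jη)⁵, κ′ = κ; for the census types w_j = the printed weight of (I.4.5), (I.4.22) (rate
κ′ = ⅓κ), (I.4.30), … — HYPOTHESES named in `CENSUS-L3-334.md` §3), the X-level (1.26) at rate κ′ (`hX`), the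
□′-count in the form #{□′}·w_j ≤ c_j (`hq`; printed case c_j = (6L)⁴L^jη, kernel `card_mul_weight_le`), the j-sum
Σ_j c_j ≤ C (`hj`; printed case C = 2(6L)⁴ = `B13Sect1Arith.jsum_le`; (L^jη)^{4+β}-classes: `jsum_rpow_le`), (1.27)
(`hY`), (1.28) (`h0`).  CONCLUSION: Σ ≤ K·O(1)·C·e·exp(⅛κ₁d_k(□₀))·exp(−(1/16)κ₁d_k(Y)) — the shape (1.29) for every
census type whose j-weights are summable uniformly in k. [cite: Balaban1988RG2Cluster, (1.29) p.8] -/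
theorem gather_weighted {α β γ δ : Type*} (S0 : Finset α) (SY : α → Finset β) (k : ℕ) (Sq : ℕ → Finset γ)
    (SX : ℕ → γ → Finset δ) (T : α → β → ℕ → γ → δ → ℝ) (w c : ℕ → ℝ) (dj : ℕ → γ → δ → ℝ) (n : α → β → ℝ)
    {K O1 C d d0 κ κ₁ : ℝ} (hK : 0 ≤ K) (hO1 : 0 ≤ O1) (hC : 0 ≤ C) (hw : ∀ j, 0 ≤ w j)
    (hT : ∀ a ∈ S0, ∀ y ∈ SY a, ∀ j ∈ Finset.range (k + 1), ∀ q ∈ Sq j, ∀ x ∈ SX j q,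
      T a y j q x ≤ K * w j * Real.exp (-(κ * dj j q x)) *
        Real.exp (-(1 / 8) * (κ₁ - 1) * d + (1 / 8) * κ₁ * d0 - (1 / 2) * (κ₁ - 1) * n a y))
    (hX : ∀ j ∈ Finset.range (k + 1), ∀ q ∈ Sq j, ∑ x ∈ SX j q, Real.exp (-(κ * dj j q x)) ≤ O1)
    (hq : ∀ j ∈ Finset.range (k + 1), ((Sq j).card : ℝ) * w j ≤ c j)
    (hj : ∑ j ∈ Finset.range (k + 1), c j ≤ C)
    (hY : ∀ a ∈ S0, ∑ y ∈ SY a, Real.exp (-(1 / 2) * (κ₁ - 1) * n a y) ≤ Real.exp 1)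
    (h0 : (S0.card : ℝ) ≤ Real.exp ((1 / 16) * (κ₁ - 2) * d)) :
    ∑ a ∈ S0, ∑ y ∈ SY a, ∑ j ∈ Finset.range (k + 1), ∑ q ∈ Sq j, ∑ x ∈ SX j q, T a y j q x
      ≤ K * O1 * C * Real.exp 1 * Real.exp ((1 / 8) * κ₁ * d0) * Real.exp (-(1 / 16) * κ₁ * d) := by
  set A := Real.exp (-(1 / 8) * (κ₁ - 1) * d + (1 / 8) * κ₁ * d0) with hA
  have hA0 : 0 < A := Real.exp_pos _
  have hsplit : ∀ a y, Real.exp (-(1 / 8) * (κ₁ - 1) * d + (1 / 8) * κ₁ * d0 - (1 / 2) * (κ₁ - 1) * n a y)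
      = A * Real.exp (-(1 / 2) * (κ₁ - 1) * n a y) := by
    intro a y; rw [hA, ← Real.exp_add]; ring_nf
  -- level X
  have hLX : ∀ a ∈ S0, ∀ y ∈ SY a, ∀ j ∈ Finset.range (k + 1), ∀ q ∈ Sq j,
      ∑ x ∈ SX j q, T a y j q x ≤ K * w j * O1 * (A * Real.exp (-(1 / 2) * (κ₁ - 1) * n a y)) := by
    intro a ha y hy j hj' q hq'
    calc ∑ x ∈ SX j q, T a y j q x
        ≤ ∑ x ∈ SX j q, K * w j * Real.exp (-(κ * dj j q x)) * (A * Real.exp (-(1 / 2) * (κ₁ - 1) * n a y)) :=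
          Finset.sum_le_sum fun x hx => by rw [← hsplit]; exact hT a ha y hy j hj' q hq' x hx
      _ = K * w j * (A * Real.exp (-(1 / 2) * (κ₁ - 1) * n a y)) * ∑ x ∈ SX j q, Real.exp (-(κ * dj j q x)) := by
          rw [Finset.mul_sum]; refine Finset.sum_congr rfl fun x _ => by ring
      _ ≤ K * w j * (A * Real.exp (-(1 / 2) * (κ₁ - 1) * n a y)) * O1 :=
          mul_le_mul_of_nonneg_left (hX j hj' q hq')
            (mul_nonneg (mul_nonneg hK (hw j)) (by positivity))
      _ = _ := by ring
  -- level □′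
  have hLq : ∀ a ∈ S0, ∀ y ∈ SY a, ∀ j ∈ Finset.range (k + 1),
      ∑ q ∈ Sq j, ∑ x ∈ SX j q, T a y j q x ≤ K * O1 * c j * (A * Real.exp (-(1 / 2) * (κ₁ - 1) * n a y)) := by
    intro a ha y hy j hj'
    calc ∑ q ∈ Sq j, ∑ x ∈ SX j q, T a y j q x
        ≤ (Sq j).card * (K * w j * O1 * (A * Real.exp (-(1 / 2) * (κ₁ - 1) * n a y))) :=
          B13Sect1Arith.sum_le_card_mul _ _ _ fun q hq' => hLX a ha y hy j hj' q hq'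
      _ = K * O1 * (((Sq j).card : ℝ) * w j) * (A * Real.exp (-(1 / 2) * (κ₁ - 1) * n a y)) := by ring
      _ ≤ K * O1 * c j * (A * Real.exp (-(1 / 2) * (κ₁ - 1) * n a y)) := by
          refine mul_le_mul_of_nonneg_right (mul_le_mul_of_nonneg_left (hq j hj') (by positivity)) (by positivity)
  -- level j
  have hLj : ∀ a ∈ S0, ∀ y ∈ SY a,
      ∑ j ∈ Finset.range (k + 1), ∑ q ∈ Sq j, ∑ x ∈ SX j q, T a y j q x
        ≤ K * O1 * C * (A * Real.exp (-(1 / 2) * (κ₁ - 1) * n a y)) := by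
    intro a ha y hy
    calc ∑ j ∈ Finset.range (k + 1), ∑ q ∈ Sq j, ∑ x ∈ SX j q, T a y j q x
        ≤ ∑ j ∈ Finset.range (k + 1), K * O1 * c j * (A * Real.exp (-(1 / 2) * (κ₁ - 1) * n a y)) :=
          Finset.sum_le_sum fun j hj' => hLq a ha y hy j hj'
      _ = K * O1 * (A * Real.exp (-(1 / 2) * (κ₁ - 1) * n a y)) * ∑ j ∈ Finset.range (k + 1), c j := by
          rw [Finset.mul_sum]; refine Finset.sum_congr rfl fun j _ => by ring
      _ ≤ K * O1 * (A * Real.exp (-(1 / 2) * (κ₁ - 1) * n a y)) * C :=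
          mul_le_mul_of_nonneg_left hj (by positivity)
      _ = _ := by ring
  -- level Y₀
  have hLY : ∀ a ∈ S0, ∑ y ∈ SY a, ∑ j ∈ Finset.range (k + 1), ∑ q ∈ Sq j, ∑ x ∈ SX j q, T a y j q x
      ≤ K * O1 * C * A * Real.exp 1 := by
    intro a ha
    calc ∑ y ∈ SY a, ∑ j ∈ Finset.range (k + 1), ∑ q ∈ Sq j, ∑ x ∈ SX j q, T a y j q x
        ≤ ∑ y ∈ SY a, K * O1 * C * (A * Real.exp (-(1 / 2) * (κ₁ - 1) * n a y)) :=
          Finset.sum_le_sum fun y hy => hLj a ha y hy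
      _ = K * O1 * C * A * ∑ y ∈ SY a, Real.exp (-(1 / 2) * (κ₁ - 1) * n a y) := by
          rw [Finset.mul_sum]; refine Finset.sum_congr rfl fun y _ => by ring
      _ ≤ K * O1 * C * A * Real.exp 1 := mul_le_mul_of_nonneg_left (hY a ha) (by positivity)
  -- level □₀ and the exponent identity
  calc ∑ a ∈ S0, ∑ y ∈ SY a, ∑ j ∈ Finset.range (k + 1), ∑ q ∈ Sq j, ∑ x ∈ SX j q, T a y j q x
      ≤ S0.card * (K * O1 * C * A * Real.exp 1) := B13Sect1Arith.sum_le_card_mul _ _ _ hLY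
    _ ≤ Real.exp ((1 / 16) * (κ₁ - 2) * d) * (K * O1 * C * A * Real.exp 1) :=
        mul_le_mul_of_nonneg_right h0 (by positivity)
    _ = K * O1 * C * Real.exp 1 * (A * Real.exp ((1 / 16) * (κ₁ - 2) * d)) := by ring
    _ = _ := by rw [hA, B13Sect1Arith.exponent_129]; ring

/-- **(1.29) FOR X-PRE-SUMMED TYPES** ((I.4.36): *"|Σ_{X∈D⁰_j, X∩(□²)ᶜ≠∅}E^{(2)}_{μν}(X,x,y)| ≦ O(1)E₀exp(−(L^jη)⁻¹)
exp(−δ₁|x−y|), for x ∈ □"*; (I.5.43)–(5.44): Π′ = a sum over X ∈ D⁰_j): such a term is indexed by (□₀, Y₀, j) and an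
inner SITE index ι ∈ `SI j` (x ∈ □, y ∈ Z⁴, …) instead of (□′, X), with term bound K·R_j(ι)·(1.25)-factor (`hT`),
the printed site/kernel sums Σ_ι R_j(ι) ≤ W_j (`hI`: #sites M⁴(L^jη)⁻⁴ × moment sums c_a(δ₁) × field powers —
HYPOTHESES) and Σ_j W_j ≤ C (`hj`, kernel for the census weights: `weight_exp_le`, `jsum_rpow_le`); (1.26) is not
needed.  CONCLUSION: the same (1.29) shape K·C·e·exp(⅛κ₁d_k(□₀))·exp(−(1/16)κ₁d_k(Y)).
[cite: Balaban1988RG2Cluster, (1.29) p.8] [cite: Balaban1987RG1, (4.36) p.290] -/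
theorem gather_sites {α β γ : Type*} (S0 : Finset α) (SY : α → Finset β) (k : ℕ) (SI : ℕ → Finset γ)
    (T : α → β → ℕ → γ → ℝ) (R : ℕ → γ → ℝ) (W : ℕ → ℝ) (n : α → β → ℝ)
    {K C d d0 κ₁ : ℝ} (hK : 0 ≤ K) (hC : 0 ≤ C)
    (hT : ∀ a ∈ S0, ∀ y ∈ SY a, ∀ j ∈ Finset.range (k + 1), ∀ i ∈ SI j,
      T a y j i ≤ K * R j i *
        Real.exp (-(1 / 8) * (κ₁ - 1) * d + (1 / 8) * κ₁ * d0 - (1 / 2) * (κ₁ - 1) * n a y))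
    (hI : ∀ j ∈ Finset.range (k + 1), ∑ i ∈ SI j, R j i ≤ W j)
    (hj : ∑ j ∈ Finset.range (k + 1), W j ≤ C)
    (hY : ∀ a ∈ S0, ∑ y ∈ SY a, Real.exp (-(1 / 2) * (κ₁ - 1) * n a y) ≤ Real.exp 1)
    (h0 : (S0.card : ℝ) ≤ Real.exp ((1 / 16) * (κ₁ - 2) * d)) :
    ∑ a ∈ S0, ∑ y ∈ SY a, ∑ j ∈ Finset.range (k + 1), ∑ i ∈ SI j, T a y j i
      ≤ K * C * Real.exp 1 * Real.exp ((1 / 8) * κ₁ * d0) * Real.exp (-(1 / 16) * κ₁ * d) := by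
  set A := Real.exp (-(1 / 8) * (κ₁ - 1) * d + (1 / 8) * κ₁ * d0) with hA
  have hA0 : 0 < A := Real.exp_pos _
  have hsplit : ∀ a y, Real.exp (-(1 / 8) * (κ₁ - 1) * d + (1 / 8) * κ₁ * d0 - (1 / 2) * (κ₁ - 1) * n a y)
      = A * Real.exp (-(1 / 2) * (κ₁ - 1) * n a y) := by
    intro a y; rw [hA, ← Real.exp_add]; ring_nf
  -- level ι
  have hLI : ∀ a ∈ S0, ∀ y ∈ SY a, ∀ j ∈ Finset.range (k + 1),
      ∑ i ∈ SI j, T a y j i ≤ K * W j * (A * Real.exp (-(1 / 2) * (κ₁ - 1) * n a y)) := by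
    intro a ha y hy j hj'
    calc ∑ i ∈ SI j, T a y j i
        ≤ ∑ i ∈ SI j, K * R j i * (A * Real.exp (-(1 / 2) * (κ₁ - 1) * n a y)) :=
          Finset.sum_le_sum fun i hi => by rw [← hsplit]; exact hT a ha y hy j hj' i hi
      _ = K * (A * Real.exp (-(1 / 2) * (κ₁ - 1) * n a y)) * ∑ i ∈ SI j, R j i := by
          rw [Finset.mul_sum]; refine Finset.sum_congr rfl fun i _ => by ring
      _ ≤ K * (A * Real.exp (-(1 / 2) * (κ₁ - 1) * n a y)) * W j :=
          mul_le_mul_of_nonneg_left (hI j hj') (by positivity)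
      _ = _ := by ring
  -- level j
  have hLj : ∀ a ∈ S0, ∀ y ∈ SY a,
      ∑ j ∈ Finset.range (k + 1), ∑ i ∈ SI j, T a y j i
        ≤ K * C * (A * Real.exp (-(1 / 2) * (κ₁ - 1) * n a y)) := by
    intro a ha y hy
    calc ∑ j ∈ Finset.range (k + 1), ∑ i ∈ SI j, T a y j i
        ≤ ∑ j ∈ Finset.range (k + 1), K * W j * (A * Real.exp (-(1 / 2) * (κ₁ - 1) * n a y)) :=
          Finset.sum_le_sum fun j hj' => hLI a ha y hy j hj'
      _ = K * (A * Real.exp (-(1 / 2) * (κ₁ - 1) * n a y)) * ∑ j ∈ Finset.range (k + 1), W j := by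
          rw [Finset.mul_sum]; refine Finset.sum_congr rfl fun j _ => by ring
      _ ≤ K * (A * Real.exp (-(1 / 2) * (κ₁ - 1) * n a y)) * C :=
          mul_le_mul_of_nonneg_left hj (by positivity)
      _ = _ := by ring
  -- level Y₀
  have hLY : ∀ a ∈ S0, ∑ y ∈ SY a, ∑ j ∈ Finset.range (k + 1), ∑ i ∈ SI j, T a y j i
      ≤ K * C * A * Real.exp 1 := by
    intro a ha
    calc ∑ y ∈ SY a, ∑ j ∈ Finset.range (k + 1), ∑ i ∈ SI j, T a y j i
        ≤ ∑ y ∈ SY a, K * C * (A * Real.exp (-(1 / 2) * (κ₁ - 1) * n a y)) :=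
          Finset.sum_le_sum fun y hy => hLj a ha y hy
      _ = K * C * A * ∑ y ∈ SY a, Real.exp (-(1 / 2) * (κ₁ - 1) * n a y) := by
          rw [Finset.mul_sum]; refine Finset.sum_congr rfl fun y _ => by ring
      _ ≤ K * C * A * Real.exp 1 := mul_le_mul_of_nonneg_left (hY a ha) (by positivity)
  calc ∑ a ∈ S0, ∑ y ∈ SY a, ∑ j ∈ Finset.range (k + 1), ∑ i ∈ SI j, T a y j i
      ≤ S0.card * (K * C * A * Real.exp 1) := B13Sect1Arith.sum_le_card_mul _ _ _ hLY
    _ ≤ Real.exp ((1 / 16) * (κ₁ - 2) * d) * (K * C * A * Real.exp 1) :=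
        mul_le_mul_of_nonneg_right h0 (by positivity)
    _ = K * C * Real.exp 1 * (A * Real.exp ((1 / 16) * (κ₁ - 2) * d)) := by ring
    _ = _ := by rw [hA, B13Sect1Arith.exponent_129]; ring

/-! ## Part D. The weight arithmetic of the census table -/

/-- THE ELEMENTARY FACT behind *"exponentially small in L^jη … irrelevant"* ([I] p. 281–282, (4.5)) and (I.4.36):
xᵐe^{−x} ≤ mᵐe^{−m} for x ≥ 0 (maximum at x = m; from e^{x/m − 1} ≥ x/m). [folklore] -/
theorem pow_mul_exp_neg_le (m : ℕ) {x : ℝ} (hx : 0 ≤ x) :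
    x ^ m * Real.exp (-x) ≤ (m:ℝ) ^ m * Real.exp (-(m:ℝ)) := by
  rcases Nat.eq_zero_or_pos m with hm | hm
  · subst hm
    simp only [pow_zero, one_mul, CharP.cast_eq_zero, neg_zero, Real.exp_zero]
    rw [← Real.exp_zero]
    exact Real.exp_le_exp.mpr (by linarith)
  · have hm' : (0:ℝ) < m := by exact_mod_cast hm
    have h1 : x / m ≤ Real.exp (x / m - 1) := by
      have := Real.add_one_le_exp (x / m - 1); linarith
    have h2 : (x / m) ^ m ≤ Real.exp (x / m - 1) ^ m :=
      pow_le_pow_left₀ (div_nonneg hx hm'.le) h1 m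
    rw [← Real.exp_nat_mul] at h2
    have h3 : (m:ℝ) * (x / m - 1) = x - m := by field_simp
    rw [h3, div_pow, div_le_iff₀ (pow_pos hm' m)] at h2
    have h4 : Real.exp (x - m) = Real.exp x * Real.exp (-(m:ℝ)) := by rw [← Real.exp_add]; ring_nf
    rw [h4] at h2
    have hex : 0 < Real.exp x := Real.exp_pos x
    have e5 : x ^ m * Real.exp (-x) = x ^ m / Real.exp x := by rw [Real.exp_neg, div_eq_mul_inv]
    rw [e5, div_le_iff₀ hex]
    calc x ^ m ≤ Real.exp x * Real.exp (-(m:ℝ)) * (m:ℝ) ^ m := h2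
      _ = (m:ℝ) ^ m * Real.exp (-(m:ℝ)) * Real.exp x := by ring

/-- u⁻ᵐe^{−a/u} ≤ (m/a)ᵐe^{−m} for u, a > 0: the exponential factors exp(−δ₀M(L^jη)⁻¹) of (I.4.5) (a = δ₀M) and
exp(−(L^jη)⁻¹) of (I.4.36) (a = 1) dominate any inverse power of u = L^jη. [folklore] -/
theorem pow_inv_exp_le (m : ℕ) {u a : ℝ} (hu : 0 < u) (ha : 0 < a) :
    (u⁻¹) ^ m * Real.exp (-(a / u)) ≤ ((m:ℝ) / a) ^ m * Real.exp (-(m:ℝ)) := by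
  have h := pow_mul_exp_neg_le m (x := a / u) (by positivity)
  have e1 : (u⁻¹) ^ m * Real.exp (-(a / u)) = (a⁻¹) ^ m * ((a / u) ^ m * Real.exp (-(a / u))) := by
    rw [div_eq_mul_inv a u, mul_pow, ← mul_assoc, ← mul_assoc, ← mul_pow, inv_mul_cancel₀ ha.ne', one_pow,
      one_mul]
  rw [e1]
  calc (a⁻¹) ^ m * ((a / u) ^ m * Real.exp (-(a / u))) ≤ (a⁻¹) ^ m * ((m:ℝ) ^ m * Real.exp (-(m:ℝ))) :=
        mul_le_mul_of_nonneg_left h (by positivity)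
    _ = ((m:ℝ) / a) ^ m * Real.exp (-(m:ℝ)) := by rw [div_eq_mul_inv, mul_pow]; ring

/-- **THE m < n TERMS (I.4.1)/(I.4.5) AND THE (I.4.36)-TYPE TERMS ARE DOMINATED BY THE (L^jη)⁵-CLASS**: for
n + m = 5 and ℓ = L^jη > 0, a > 0: ℓⁿ·e^{−a/ℓ} ≤ (m/a)ᵐe^{−m}·ℓ⁵.  Hence the weight (2n²B₃α₁/α₂)ⁿ2ⁿE₀ℓⁿe^{−δ₀M/ℓ}
e^{−κd_j(X)} of a (4.5)-term (census type T1; |B| < α₁ℓ) is ≤ constant·E₀ℓ⁵e^{−κd_j(X)} — the weight of the worked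
example — and its (□′, X, j)-sums close by (1.26), *"(6L)⁴L^jη"* and *"2(6L)⁴"* verbatim; likewise M⁴ℓ⁻⁴·ℓᵖe^{−1/ℓ}
(type T3d, p ≤ 5). [cite: Balaban1987RG1, (4.5) p.282] [cite: Balaban1988RG2Cluster, p.8] -/
theorem weight_exp_le (n m : ℕ) (hmn : n + m = 5) {ℓ a : ℝ} (hℓ : 0 < ℓ) (ha : 0 < a) :
    ℓ ^ n * Real.exp (-(a / ℓ)) ≤ ((m:ℝ) / a) ^ m * Real.exp (-(m:ℝ)) * ℓ ^ 5 := by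
  have hℓ0 : ℓ ≠ 0 := hℓ.ne'
  have e1 : ℓ ^ 5 * (ℓ⁻¹) ^ m = ℓ ^ n := by
    rw [← hmn, pow_add, mul_assoc, ← mul_pow, mul_inv_cancel₀ hℓ0, one_pow, mul_one]
  have h := pow_inv_exp_le m hℓ ha
  calc ℓ ^ n * Real.exp (-(a / ℓ)) = ℓ ^ 5 * ((ℓ⁻¹) ^ m * Real.exp (-(a / ℓ))) := by rw [← e1]; ring
    _ ≤ ℓ ^ 5 * (((m:ℝ) / a) ^ m * Real.exp (-(m:ℝ))) := mul_le_mul_of_nonneg_left h (by positivity)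
    _ = ((m:ℝ) / a) ^ m * Real.exp (-(m:ℝ)) * ℓ ^ 5 := by ring

/-- *"To bound the first sum, over □′ ⊂ □̃², we use the factor (L^jη)⁵ in (1.24). This yields (6L)⁴L^jη"* ([II] p. 8)
— the □′-COUNT STEP for any weight of the form C·ℓ⁵: with #{□′ ∈ π_j : □′ ⊂ □̃²} ≤ A·ℓ⁻⁴ (A = (6L)⁴, the paper's
numeral, a HYPOTHESIS) one gets #·(Cℓ⁵) ≤ A·C·ℓ — the hypothesis `hq` of `gather_weighted` with c_j = A·C·ℓ_j.
[cite: Balaban1988RG2Cluster, p.8] -/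
theorem card_mul_weight_le {N A C ℓ : ℝ} (hℓ : 0 < ℓ) (hC : 0 ≤ C) (hN : N ≤ A * (ℓ⁻¹) ^ 4) :
    N * (C * ℓ ^ 5) ≤ A * C * ℓ := by
  have hℓ0 : ℓ ≠ 0 := hℓ.ne'
  calc N * (C * ℓ ^ 5) ≤ A * (ℓ⁻¹) ^ 4 * (C * ℓ ^ 5) := mul_le_mul_of_nonneg_right hN (by positivity)
    _ = A * C * (ℓ * (ℓ * ℓ⁻¹) ^ 4) := by ring
    _ = A * C * ℓ := by rw [mul_inv_cancel₀ hℓ0, one_pow, mul_one]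

/-- *"and the sum over j is bounded by 2(6L)⁴"* ([II] p. 8) with a constant weight factor: Σ_{j≤k}(6L)⁴·(C·L^jη) ≤
C·2(6L)⁴ (η = L^{−k}, L ≥ 2; from `B13Sect1Arith.jsum_le`). [cite: Balaban1988RG2Cluster, p.8] -/
theorem jsum_scaled_le {L C : ℝ} (hL : 2 ≤ L) (hC : 0 ≤ C) (k : ℕ) :
    ∑ j ∈ Finset.range (k + 1), (6 * L) ^ 4 * (C * (L ^ j * (L ^ k)⁻¹)) ≤ C * (2 * (6 * L) ^ 4) := by
  have h := B13Sect1Arith.jsum_le hL k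
  calc ∑ j ∈ Finset.range (k + 1), (6 * L) ^ 4 * (C * (L ^ j * (L ^ k)⁻¹))
      = C * ∑ j ∈ Finset.range (k + 1), (6 * L) ^ 4 * (L ^ j * (L ^ k)⁻¹) := by
        rw [Finset.mul_sum]; exact Finset.sum_congr rfl fun j _ => by ring
    _ ≤ C * (2 * (6 * L) ^ 4) := mul_le_mul_of_nonneg_left h hC

/-- The geometric ratio sum: for Λ > 1, Σ_{j=0}^{k} Λ^j·(Λ^k)⁻¹ = (Λ − Λ^{−k})/(Λ − 1) ≤ Λ/(Λ − 1), uniformly in k.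
[folklore] -/
theorem geom_ratio_sum_le {Λ : ℝ} (hΛ : 1 < Λ) (k : ℕ) :
    ∑ j ∈ Finset.range (k + 1), Λ ^ j * (Λ ^ k)⁻¹ ≤ Λ / (Λ - 1) := by
  have hΛ0 : 0 < Λ := by linarith
  have hgeom : ∑ j ∈ Finset.range (k + 1), Λ ^ j = (Λ ^ (k + 1) - 1) / (Λ - 1) :=
    geom_sum_eq hΛ.ne' (k + 1)
  rw [← Finset.sum_mul, hgeom, div_mul_eq_mul_div]
  apply div_le_div_of_nonneg_right _ (by linarith)
  rw [pow_succ]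
  have hk : 0 < Λ ^ k := pow_pos hΛ0 k
  have e : (Λ ^ k * Λ - 1) * (Λ ^ k)⁻¹ = Λ - (Λ ^ k)⁻¹ := by field_simp
  rw [e]
  have : 0 < (Λ ^ k)⁻¹ := inv_pos.mpr hk
  linarith

/-- (L^j·(L^k)⁻¹)^β = (L^β)^j·((L^β)^k)⁻¹ for L > 0 (`Real.rpow` algebra): the (L^jη)^β-weight is a geometric ratio
with base Λ = L^β. [folklore] -/
theorem rpow_ratio_eq {L : ℝ} (hL : 0 < L) (β : ℝ) (j k : ℕ) :
    (L ^ j * (L ^ k)⁻¹) ^ β = (L ^ β) ^ j * ((L ^ β) ^ k)⁻¹ := by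
  have e : ∀ n : ℕ, (L ^ n) ^ β = (L ^ β) ^ n := fun n => by
    rw [← Real.rpow_natCast_mul hL.le, mul_comm, Real.rpow_mul_natCast hL.le]
  rw [Real.mul_rpow (by positivity) (by positivity), Real.inv_rpow (by positivity), e j, e k]

/-- **THE j-SUM OF THE (L^jη)^{4+β}-CLASSES** ((I.4.30) *"the bound (4.22) with the power 4 + β instead of 5"*, and
the third-order terms of (I.5.43) via (I.4.17)–(4.18)): after the □′-count (#□′·ℓ^{4+β} ≤ (6L)⁴ℓ^β) resp. the site
count, the j-sum is Σ_{j=0}^{k}(L^jη)^β ≤ (1 − L^{−β})⁻¹ for η = L^{−k}, L > 1 and β > 0 — uniformly in k BECAUSE β > 0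
(at β = 0 the sum is k + 1): the constant of (1.29)/(1.36) for these classes depends on the Hölder exponent β of
(I.3.31) (cell GAPS G-B13-14b). [cite: Balaban1987RG1, (4.30) p.288] [cite: Balaban1988RG2Cluster, p.8] -/
theorem jsum_rpow_le {L β : ℝ} (hL : 1 < L) (hβ : 0 < β) (k : ℕ) :
    ∑ j ∈ Finset.range (k + 1), (L ^ j * (L ^ k)⁻¹) ^ β ≤ (1 - L ^ (-β))⁻¹ := by
  have hL0 : 0 < L := by linarith
  have hΛ : 1 < L ^ β := Real.one_lt_rpow hL hβ
  have hΛne : L ^ β ≠ 0 := by positivity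
  simp_rw [rpow_ratio_eq hL0 β]
  refine (geom_ratio_sum_le hΛ k).trans (le_of_eq ?_)
  rw [Real.rpow_neg hL0.le]
  simp only [inv_eq_one_div]
  rw [one_sub_div hΛne, one_div_div]

/-- The (L^jη)^{4+β}-class in the form of the hypothesis `hj` of `gather_weighted`: Σ_{j≤k} A·C·(L^jη)^β ≤
A·C·(1 − L^{−β})⁻¹. [cite: Balaban1988RG2Cluster, p.8] -/
theorem jsum_rpow_scaled_le {L β A C : ℝ} (hL : 1 < L) (hβ : 0 < β) (hA : 0 ≤ A) (hC : 0 ≤ C) (k : ℕ) :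
    ∑ j ∈ Finset.range (k + 1), A * C * (L ^ j * (L ^ k)⁻¹) ^ β ≤ A * C * (1 - L ^ (-β))⁻¹ := by
  rw [← Finset.mul_sum]
  exact mul_le_mul_of_nonneg_left (jsum_rpow_le hL hβ k) (mul_nonneg hA hC)

end Literature.MathematicalPhysics.QuantumFieldTheory.Balaban1983to89.B13TermCensus334
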